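import Summits.KontsevichZagierPeriods.KontsevichZagierPeriods.Theorems.HurwitzMicroSectorsNormalFormPrincipleM4SimplexFacts
import Summits.KontsevichZagierPeriods.KontsevichZagierPeriods.Theorems.OctahedralSymmetryOctahedralInvolutionMove

/-!
# `NormalFormPrinciple` (stmt-KontsevichZagierPeriods-3869), line `SketchIdeator1` —
# leaf `stub_boxRigidity`, layer `M4` toolkit: the Möbius move on `Δ₄`

Pure proof file (registered sub-goal `m4_moebius_move4` of stmt-KontsevichZagierPeriods-3869, line
`SketchIdeator1`, lead seat c9; layer `M4` toolkit = the dimension-four campaign of the leaf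
`stub_boxRigidity`; `--supports` the crux). On the decreasing open simplex
`Δ₄ = {t | 0 < t₃ < t₂ < t₁ < t₀ < 1} ⊆ ℝ⁴` a *word representation* is
`[Δ₄, x(t₀) y(t₁) z(t₂) w(t₃)]` for letters `x, y, z, w : ℝ → ℝ` (the iterated integral
`∫ x y z w` over `1 > t₀ > t₁ > t₂ > t₃ > 0`). The MÖBIUS INVOLUTION `σ(u) = (1 − u)/(1 + u)` of
`(0,1)` (decreasing, `σ 0 = 1`, `σ 1 = 0`, `σ ∘ σ = id`, `σ'(u) = −2/(1 + u)²`), applied to all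
four coordinates WITH ORDER REVERSAL,

  `Φ(t) = (σ t₃, σ t₂, σ t₁, σ t₀)`,  `Φ '' Δ₄ = Δ₄`,  `|det DΦ(t)| = ∏ⱼ 2/(1+tⱼ)²`,

is ONE change of variables of the Kontsevich–Zagier calculus (rule (2),
`KZ.changeOfVariablesRel`) between the word representation `T = [Δ₄, x(t₀) y(t₁) z(t₂) w(t₃)]` and
ANY representation `N` on `Δ₄` carrying the pulled-back integrand
`N(t) = (w(σ t₀)·2/(1+t₀)²)(z(σ t₁)·2/(1+t₁)²)(y(σ t₂)·2/(1+t₂)²)(x(σ t₃)·2/(1+t₃)²)`, i.e.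
`N(t) = T(Φ t)·|det DΦ(t)|` (part (1), `m4m_moebius_sub_mem_relations`); and such a
representation `N` EXISTS (part (2), `m4m_exists_moebiusRep`): its integrand is
`ℚ`-semialgebraic on `Δ₄` as the composite of the `ℚ`-semialgebraic integrand of `T` with the
`ℚ`-rational chart times the `ℚ`-rational Jacobian, and absolutely integrable on `Δ₄` by
transport of `T.integrableOn` along the chart
(`MeasureTheory.integrableOn_image_iff_integrableOn_abs_det_fderiv_smul`, `Φ '' Δ₄ = Δ₄`).

The chart itself — Zhao's octahedral involution in every dimension `w`, here `w = 4` — is the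
tree's `OctahedralSymmetry.OctahedralInvolutionMove` kit (`OctahedralInvolutionMove_of`,
`hasFDerivAt_octMap`, `abs_det_octDeriv`, `bijOn_octMap`, `mapsTo_octMap`,
`isSemialgebraicMapOn_octMap`), read on `Δ₄ = KZ.openOrderedSimplex 4`
(`M3.m4s_simplex4_eq_openOrderedSimplex`); this file only supplies the pull-back identity for word
integrands and the two transports.

References: M. Kontsevich, D. Zagier, *Periods* (2001), §1.1–1.2, rule (2); J. Zhao, *Multiple
polylogarithm values at roots of unity*, C. R. Acad. Sci. Paris 346 (2008), §4 (the octahedral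
involution `σ`). No definitions are introduced.
-/

noncomputable section

open MeasureTheory Set
open Literature.NumberTheory.Transcendental Literature.NumberTheory.Transcendental.KZ
open Literature.ModelTheory.ExponentialFields (IsSemialgebraic)
open Summit.KontsevichZagierPeriods.OctahedralSymmetry.OctahedralInvolutionMove
  (OctahedralInvolutionMove_of hasFDerivAt_octMap abs_det_octDeriv bijOn_octMap mapsTo_octMap
    isSemialgebraicMapOn_octMap one_add_ne_zero_of_mem_simplex)

namespace Summit.KontsevichZagierPeriods.HurwitzMicroSectors.NormalFormPrinciple.PiBox.M3

/-! ## The Möbius chart on the decreasing open simplex `Δ₄` -/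

/-- On `Δ₄` no coordinate is `−1` (indeed `1 + tᵢ > 0`): the Möbius chart
`σ(u) = (1 − u)/(1 + u)` has no pole there. [folklore] -/
theorem m4m_one_add_ne_zero {t : Fin 4 → ℝ}
    (ht : t ∈ {t : Fin 4 → ℝ | 0 < t 3 ∧ t 3 < t 2 ∧ t 2 < t 1 ∧ t 1 < t 0 ∧ t 0 < 1}) (i : Fin 4) :
    1 + t i ≠ 0 :=
  one_add_ne_zero_of_mem_simplex (w := 4) (m4s_simplex4_eq_openOrderedSimplex.le ht) i

/-- The Möbius chart `Φ(t)ⱼ = σ(t_{3−j})`, `σ(u) = (1 − u)/(1 + u)`, maps `Δ₄` into itself (`σ` is a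
decreasing self-map of `(0,1)` and the order reversal restores the ordering of the coordinates).
[folklore] -/
theorem m4m_moebius_mem_simplex {t : Fin 4 → ℝ}
    (ht : t ∈ {t : Fin 4 → ℝ | 0 < t 3 ∧ t 3 < t 2 ∧ t 2 < t 1 ∧ t 1 < t 0 ∧ t 0 < 1}) :
    (fun j : Fin 4 => (1 - t (Fin.rev j)) / (1 + t (Fin.rev j))) ∈
      {t : Fin 4 → ℝ | 0 < t 3 ∧ t 3 < t 2 ∧ t 2 < t 1 ∧ t 1 < t 0 ∧ t 0 < 1} :=
  m4s_simplex4_eq_openOrderedSimplex.symm.le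
    (mapsTo_octMap (w := 4) (m4s_simplex4_eq_openOrderedSimplex.le ht))

/-- Each Jacobian factor `2/(1 + tᵢ)²` of the Möbius chart is a `ℚ`-semialgebraic function on
`Δ₄`: a quotient of `ℚ`-polynomials whose denominator does not vanish there. [folklore] -/
theorem m4m_isSemialgebraicFunOn_jacFactor (i : Fin 4) :
    IsSemialgebraicFunOn ℚ {t : Fin 4 → ℝ | 0 < t 3 ∧ t 3 < t 2 ∧ t 2 < t 1 ∧ t 1 < t 0 ∧ t 0 < 1}
      (fun t => 2 / (1 + t i) ^ 2) := by
  refine (isSemialgebraicFunOn_aeval_div_aeval m4s_isSemialgebraic_simplex4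
    (2 : MvPolynomial (Fin 4) ℚ) ((1 + MvPolynomial.X i) ^ 2) fun t ht => ?_).congr fun t _ => ?_
  · simp only [map_pow, map_add, map_one, MvPolynomial.aeval_X]
    exact pow_ne_zero 2 (m4m_one_add_ne_zero ht i)
  · simp only [map_ofNat, map_pow, map_add, map_one, MvPolynomial.aeval_X]

/-- The Jacobian `|det DΦ(t)| = (2/(1+t₀)²)(2/(1+t₁)²)(2/(1+t₂)²)(2/(1+t₃)²)` of the Möbius chart is
a `ℚ`-semialgebraic function on `Δ₄` (a product of four `ℚ`-semialgebraic functions). [folklore] -/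
theorem m4m_isSemialgebraicFunOn_jac :
    IsSemialgebraicFunOn ℚ {t : Fin 4 → ℝ | 0 < t 3 ∧ t 3 < t 2 ∧ t 2 < t 1 ∧ t 1 < t 0 ∧ t 0 < 1}
      (fun t => 2 / (1 + t 0) ^ 2 * (2 / (1 + t 1) ^ 2) * (2 / (1 + t 2) ^ 2) *
        (2 / (1 + t 3) ^ 2)) :=
  (IsSemialgebraicFunOn.mul_holds (IsSemialgebraicFunOn.mul_holds
    (IsSemialgebraicFunOn.mul_holds (m4m_isSemialgebraicFunOn_jacFactor 0)
      (m4m_isSemialgebraicFunOn_jacFactor 1)) (m4m_isSemialgebraicFunOn_jacFactor 2))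
      (m4m_isSemialgebraicFunOn_jacFactor 3)).congr
    fun _ _ => rfl

/-- **The pull-back identity of the Möbius chart for word integrands.** If
`T(u) = x(u₀) y(u₁) z(u₂) w(u₃)` on `Δ₄`, then at `u = Φ(t) = (σ t₃, σ t₂, σ t₁, σ t₀)`, `t ∈ Δ₄`,
`T(Φ t) · ∏ⱼ 2/(1+tⱼ)²` equals
`(w(σ t₀)·2/(1+t₀)²)(z(σ t₁)·2/(1+t₁)²)(y(σ t₂)·2/(1+t₂)²)(x(σ t₃)·2/(1+t₃)²)`
(the letters come out in the reversed order `w z y x`). [folklore] -/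
theorem m4m_moebius_pullback (x y z w : ℝ → ℝ) (T : IntegralRep 4)
    (hTd : T.domain = {t | 0 < t 3 ∧ t 3 < t 2 ∧ t 2 < t 1 ∧ t 1 < t 0 ∧ t 0 < 1})
    (hTi : EqOn T.integrand (fun t => x (t 0) * y (t 1) * z (t 2) * w (t 3)) T.domain)
    {t : Fin 4 → ℝ}
    (ht : t ∈ {t : Fin 4 → ℝ | 0 < t 3 ∧ t 3 < t 2 ∧ t 2 < t 1 ∧ t 1 < t 0 ∧ t 0 < 1}) :
    T.integrand (fun j : Fin 4 => (1 - t (Fin.rev j)) / (1 + t (Fin.rev j))) *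
        (2 / (1 + t 0) ^ 2 * (2 / (1 + t 1) ^ 2) * (2 / (1 + t 2) ^ 2) * (2 / (1 + t 3) ^ 2)) =
      w ((1 - t 0) / (1 + t 0)) * (2 / (1 + t 0) ^ 2) *
        (z ((1 - t 1) / (1 + t 1)) * (2 / (1 + t 1) ^ 2)) *
        (y ((1 - t 2) / (1 + t 2)) * (2 / (1 + t 2) ^ 2)) *
        (x ((1 - t 3) / (1 + t 3)) * (2 / (1 + t 3) ^ 2)) := by
  have hΦt : (fun j : Fin 4 => (1 - t (Fin.rev j)) / (1 + t (Fin.rev j))) ∈ T.domain :=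
    hTd.symm.le (m4m_moebius_mem_simplex ht)
  have r0 : Fin.rev (0 : Fin 4) = 3 := by decide
  have r1 : Fin.rev (1 : Fin 4) = 2 := by decide
  have r2 : Fin.rev (2 : Fin 4) = 1 := by decide
  have r3 : Fin.rev (3 : Fin 4) = 0 := by decide
  rw [hTi hΦt]
  simp only [r0, r1, r2, r3]
  ring

/-! ## Part 1: the Möbius move (rule 2) -/

/-- **The Möbius move (rule 2) in dimension four.** For letters `x, y, z, w : ℝ → ℝ`, a
representation `T = [Δ₄, x(t₀) y(t₁) z(t₂) w(t₃)]` (integrand pinned on the domain only) and ANY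
representation `N` on `Δ₄` whose integrand agrees on `Δ₄` with the pulled-back integrand
`(w(σ t₀)·2/(1+t₀)²)(z(σ t₁)·2/(1+t₁)²)(y(σ t₂)·2/(1+t₂)²)(x(σ t₃)·2/(1+t₃)²)`,
`σ(u) = (1 − u)/(1 + u)`, the difference `[N] − [T]` is ONE change-of-variables move of the
Kontsevich–Zagier calculus along the Möbius chart `Φ(t) = (σ t₃, σ t₂, σ t₁, σ t₀)` of `Δ₄` onto
itself (Zhao's octahedral involution in dimension `4`, `OctahedralInvolutionMove_of`), the pull-back
identity `N(t) = T(Φ t)·|det DΦ(t)|` on `Δ₄` being `m4m_moebius_pullback`.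
[cite: KontsevichZagier2001, §1.2 rule (2)] -/
theorem m4m_moebius_sub_mem_relations (x y z w : ℝ → ℝ) (T : IntegralRep 4)
    (hTd : T.domain = {t | 0 < t 3 ∧ t 3 < t 2 ∧ t 2 < t 1 ∧ t 1 < t 0 ∧ t 0 < 1})
    (hTi : EqOn T.integrand (fun t => x (t 0) * y (t 1) * z (t 2) * w (t 3)) T.domain)
    (N : IntegralRep 4)
    (hNd : N.domain = {t | 0 < t 3 ∧ t 3 < t 2 ∧ t 2 < t 1 ∧ t 1 < t 0 ∧ t 0 < 1})
    (hNi : EqOn N.integrand (fun t => (w ((1 - t 0) / (1 + t 0)) * (2 / (1 + t 0) ^ 2)) *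
      (z ((1 - t 1) / (1 + t 1)) * (2 / (1 + t 1) ^ 2)) *
      (y ((1 - t 2) / (1 + t 2)) * (2 / (1 + t 2) ^ 2)) *
      (x ((1 - t 3) / (1 + t 3)) * (2 / (1 + t 3) ^ 2))) N.domain) :
    of N - of T ∈ relations := by
  refine changeOfVariablesRel_subset_relations
    (OctahedralInvolutionMove_of 4 N T (hNd.trans m4s_simplex4_eq_openOrderedSimplex)
      (hTd.trans m4s_simplex4_eq_openOrderedSimplex) fun t ht => ?_)
  -- the pull-back identity on `N.domain = Δ₄`, Jacobian `∏ⱼ 2/(1+tⱼ)²` included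
  rw [hNi ht, Fin.prod_univ_four]
  exact (m4m_moebius_pullback x y z w T hTd hTi (hNd.le ht)).symm

/-! ## Part 2: the Möbius carrier exists -/

/-- **The pulled-back representation exists.** For letters `x, y, z, w : ℝ → ℝ` and a
representation `T = [Δ₄, x(t₀) y(t₁) z(t₂) w(t₃)]` (integrand pinned on the domain only), the
decreasing open simplex `Δ₄` with the pulled-back integrand
`(w(σ t₀)·2/(1+t₀)²)(z(σ t₁)·2/(1+t₁)²)(y(σ t₂)·2/(1+t₂)²)(x(σ t₃)·2/(1+t₃)²)` is an integral
representation of the Kontsevich–Zagier calculus: on `Δ₄` this integrand equals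
`T(Φ t)·|det DΦ(t)|` (`m4m_moebius_pullback`), which is `ℚ`-semialgebraic there (composite of
`T.integrand` with the `ℚ`-rational chart, `IsSemialgebraicFunOn.comp_isSemialgebraicMapOn_holds`,
times the `ℚ`-rational Jacobian) and absolutely integrable there (transport of `T.integrableOn`
along the chart, `Φ '' Δ₄ = Δ₄`, by
`MeasureTheory.integrableOn_image_iff_integrableOn_abs_det_fderiv_smul`). Nothing about the
letters is used beyond what `T` provides. [cite: KontsevichZagier2001, §1.1–1.2] -/
theorem m4m_exists_moebiusRep (x y z w : ℝ → ℝ) (T : IntegralRep 4)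
    (hTd : T.domain = {t | 0 < t 3 ∧ t 3 < t 2 ∧ t 2 < t 1 ∧ t 1 < t 0 ∧ t 0 < 1})
    (hTi : EqOn T.integrand (fun t => x (t 0) * y (t 1) * z (t 2) * w (t 3)) T.domain) :
    ∃ N : IntegralRep 4, N.domain = {t | 0 < t 3 ∧ t 3 < t 2 ∧ t 2 < t 1 ∧ t 1 < t 0 ∧ t 0 < 1} ∧
      N.integrand = fun t => (w ((1 - t 0) / (1 + t 0)) * (2 / (1 + t 0) ^ 2)) *
        (z ((1 - t 1) / (1 + t 1)) * (2 / (1 + t 1) ^ 2)) *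
        (y ((1 - t 2) / (1 + t 2)) * (2 / (1 + t 2) ^ 2)) *
        (x ((1 - t 3) / (1 + t 3)) * (2 / (1 + t 3) ^ 2)) := by
  -- the chart is `ℚ`-semialgebraic on `Δ₄` and maps `Δ₄` into `T.domain = Δ₄`
  have hF : IsSemialgebraicMapOn ℚ
      {t : Fin 4 → ℝ | 0 < t 3 ∧ t 3 < t 2 ∧ t 2 < t 1 ∧ t 1 < t 0 ∧ t 0 < 1}
      (fun (t : Fin 4 → ℝ) (j : Fin 4) => (1 - t (Fin.rev j)) / (1 + t (Fin.rev j))) :=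
    isSemialgebraicMapOn_octMap m4s_isSemialgebraic_simplex4 fun _ ht => m4m_one_add_ne_zero ht
  have hmaps : MapsTo
      (fun (t : Fin 4 → ℝ) (j : Fin 4) => (1 - t (Fin.rev j)) / (1 + t (Fin.rev j)))
      {t : Fin 4 → ℝ | 0 < t 3 ∧ t 3 < t 2 ∧ t 2 < t 1 ∧ t 1 < t 0 ∧ t 0 < 1} T.domain :=
    fun t ht => hTd.symm.le (m4m_moebius_mem_simplex ht)
  -- the pulled-back integrand `(T.integrand ∘ Φ) · |det DΦ|` is `ℚ`-semialgebraic on `Δ₄`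
  have hsa : IsSemialgebraicFunOn ℚ
      {t : Fin 4 → ℝ | 0 < t 3 ∧ t 3 < t 2 ∧ t 2 < t 1 ∧ t 1 < t 0 ∧ t 0 < 1}
      (fun t => (w ((1 - t 0) / (1 + t 0)) * (2 / (1 + t 0) ^ 2)) *
        (z ((1 - t 1) / (1 + t 1)) * (2 / (1 + t 1) ^ 2)) *
        (y ((1 - t 2) / (1 + t 2)) * (2 / (1 + t 2) ^ 2)) *
        (x ((1 - t 3) / (1 + t 3)) * (2 / (1 + t 3) ^ 2))) :=
    (IsSemialgebraicFunOn.mul_holds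
      (IsSemialgebraicFunOn.comp_isSemialgebraicMapOn_holds T.isSemialgebraicFunOn_integrand hF
        hmaps) m4m_isSemialgebraicFunOn_jac).congr
      fun t ht => m4m_moebius_pullback x y z w T hTd hTi ht
  -- ... and absolutely integrable on `Δ₄`: transport of `T.integrableOn` along the chart
  have hint : IntegrableOn
      (fun t => (w ((1 - t 0) / (1 + t 0)) * (2 / (1 + t 0) ^ 2)) *
        (z ((1 - t 1) / (1 + t 1)) * (2 / (1 + t 1) ^ 2)) *
        (y ((1 - t 2) / (1 + t 2)) * (2 / (1 + t 2) ^ 2)) *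
        (x ((1 - t 3) / (1 + t 3)) * (2 / (1 + t 3) ^ 2)))
      {t : Fin 4 → ℝ | 0 < t 3 ∧ t 3 < t 2 ∧ t 2 < t 1 ∧ t 1 < t 0 ∧ t 0 < 1} := by
    have hinj : InjOn
        (fun (t : Fin 4 → ℝ) (j : Fin 4) => (1 - t (Fin.rev j)) / (1 + t (Fin.rev j)))
        {t : Fin 4 → ℝ | 0 < t 3 ∧ t 3 < t 2 ∧ t 2 < t 1 ∧ t 1 < t 0 ∧ t 0 < 1} :=
      fun a ha b hb hab => (bijOn_octMap (w := 4)).injOn (m4s_simplex4_eq_openOrderedSimplex.le ha)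
        (m4s_simplex4_eq_openOrderedSimplex.le hb) hab
    have hsub :
        (fun (t : Fin 4 → ℝ) (j : Fin 4) => (1 - t (Fin.rev j)) / (1 + t (Fin.rev j))) ''
          {t : Fin 4 → ℝ | 0 < t 3 ∧ t 3 < t 2 ∧ t 2 < t 1 ∧ t 1 < t 0 ∧ t 0 < 1} ⊆ T.domain := by
      rintro _ ⟨u, hu, rfl⟩
      exact hmaps hu
    have key := (integrableOn_image_iff_integrableOn_abs_det_fderiv_smul volume
      m4s_measurableSet_simplex4
      (fun t ht => (hasFDerivAt_octMap (m4m_one_add_ne_zero ht)).hasFDerivWithinAt) hinj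
      T.integrand).1 (T.integrableOn.mono_set hsub)
    refine key.congr_fun (fun t ht => ?_) m4s_measurableSet_simplex4
    simp only [smul_eq_mul, abs_det_octDeriv, Fin.prod_univ_four]
    exact (mul_comm _ _).trans (m4m_moebius_pullback x y z w T hTd hTi ht)
  exact ⟨⟨_, _, m4s_isSemialgebraic_simplex4, hsa, hint⟩, rfl, rfl⟩

/-! ## The registered sub-goal -/

/-- **Stub `m4_moebius_move4` (registered sub-goal of stmt-KontsevichZagierPeriods-3869, line
`SketchIdeator1`, layer `M4` toolkit).** The Möbius involution `σ(u) = (1 − u)/(1 + u)` applied to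
all four coordinates with order reversal, `Φ(t) = (σ t₃, σ t₂, σ t₁, σ t₀)`, maps the decreasing
open simplex `Δ₄ = {0 < t₃ < t₂ < t₁ < t₀ < 1}` onto itself with
`|det DΦ(t)| = ∏ⱼ 2/(1+tⱼ)²`; for a word representation `T = [Δ₄, x(t₀) y(t₁) z(t₂) w(t₃)]`:
(1) for every representation `N` on `Δ₄` carrying the pulled-back integrand
`(w(σ t₀)·2/(1+t₀)²)(z(σ t₁)·2/(1+t₁)²)(y(σ t₂)·2/(1+t₂)²)(x(σ t₃)·2/(1+t₃)²)`,
`[N] − [T] ∈ KZ.relations` as ONE rule-(2) move (`m4m_moebius_sub_mem_relations`); (2) such an `N`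
exists (`m4m_exists_moebiusRep`). [cite: KontsevichZagier2001, §1.2 rule (2)] -/
theorem m4_moebius_move4 :
    ∀ (x y z w : ℝ → ℝ) (T : IntegralRep 4),
      T.domain = {t | 0 < t 3 ∧ t 3 < t 2 ∧ t 2 < t 1 ∧ t 1 < t 0 ∧ t 0 < 1} →
      EqOn T.integrand (fun t => x (t 0) * y (t 1) * z (t 2) * w (t 3)) T.domain →
      (∀ N : IntegralRep 4, N.domain = {t | 0 < t 3 ∧ t 3 < t 2 ∧ t 2 < t 1 ∧ t 1 < t 0 ∧ t 0 < 1} →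
        EqOn N.integrand (fun t => (w ((1 - t 0) / (1 + t 0)) * (2 / (1 + t 0) ^ 2)) *
          (z ((1 - t 1) / (1 + t 1)) * (2 / (1 + t 1) ^ 2)) *
          (y ((1 - t 2) / (1 + t 2)) * (2 / (1 + t 2) ^ 2)) *
          (x ((1 - t 3) / (1 + t 3)) * (2 / (1 + t 3) ^ 2))) N.domain →
        of N - of T ∈ relations) ∧
      (∃ N : IntegralRep 4, N.domain = {t | 0 < t 3 ∧ t 3 < t 2 ∧ t 2 < t 1 ∧ t 1 < t 0 ∧ t 0 < 1} ∧
        N.integrand = fun t => (w ((1 - t 0) / (1 + t 0)) * (2 / (1 + t 0) ^ 2)) *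
          (z ((1 - t 1) / (1 + t 1)) * (2 / (1 + t 1) ^ 2)) *
          (y ((1 - t 2) / (1 + t 2)) * (2 / (1 + t 2) ^ 2)) *
          (x ((1 - t 3) / (1 + t 3)) * (2 / (1 + t 3) ^ 2))) :=
  fun x y z w T hTd hTi =>
    ⟨fun N hNd hNi => m4m_moebius_sub_mem_relations x y z w T hTd hTi N hNd hNi,
      m4m_exists_moebiusRep x y z w T hTd hTi⟩

end Summit.KontsevichZagierPeriods.HurwitzMicroSectors.NormalFormPrinciple.PiBox.M3
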